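import Mathlib
import Literature.Analysis.FluidPDE.VectorCalculus
import Summits.NavierStokesRegularity.NavierStokesRegularity.Theorems.FilamentSkeletonRssSkeletonEquilibriumLineBiotSavart

/-!
# Route FilamentSkeletonRss · crux `CoreGluing` (stmt-NavierStokesRegularity-15401) — far-field obstruction

Tools stub `stub_farFieldObstruction` of line `zero-accretion-selection` (lead a1).  It records WHY the
closeness clause of the planner's `stub_transverseReduction` had to be windowed (reshape 1 of the
skeleton `Cruxes/CoreGluing/Lines/zero_accretion_selection.lean`):

a field `U` with the profile Type-I envelope `‖U y‖ ≤ C₀ / (1 + ‖y‖)` cannot stay `η√Γ`-close, at ALL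
points off the `ρ√Γ/4`-tube, to the thin-filament (Rosenhead-regularised, core `1`) Biot–Savart field of a
straight vortex line of circulation `Γγ` unless `η ≥ |γ| / (πρ)`.  Indeed on the tube boundary
`dist = d := ρ√Γ/4 ≥ 1` the line field has speed `Γ|γ| d / (2π(d² + 1)) ≥ |γ|√Γ/(πρ)` however far
along the line one goes (`stub_lineBiotSavart`, the Lorentzian `2/(d²+1)`), while the envelope forces
`U → 0` there.  Every proper filament end of a skeleton is straight on the scale `d` (curvature
`≤ K/√Γ`), so the un-windowed clause `∀ y off the tubes, ‖U p y − u p (X p) y‖ ≤ η√Γ` together with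
`∀ η > 0` made the registered conclusion unsatisfiable on the intended data; the exact straight-line case
below is the kernel-checked certificate of the scaling clash (both sides are `O(√Γ)`, the ratio is
`Γ`-independent).
-/

set_option linter.dupNamespace false

noncomputable section

namespace Summit.NavierStokesRegularity.NavierStokesRegularity.Theorems

open Set Function Filter MeasureTheory Real
open Literature.Analysis.FluidPDE
open scoped RealInnerProductSpace

/-- `e × (s e + d n) = d (e × n)`. [folklore] -/
private theorem farField_cross_add_smul (e n : EuclideanSpace ℝ (Fin 3)) (s d : ℝ) :
    cross e (s • e + d • n) = d • cross e n := by
  ext i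
  fin_cases i <;> simp [cross, crossProduct] <;> ring

/-- For orthogonal unit vectors `‖e × n‖ = 1`. [folklore] -/
private theorem farField_norm_cross_of_orthonormal {e n : EuclideanSpace ℝ (Fin 3)} (he : ‖e‖ = 1)
    (hn : ‖n‖ = 1) (hne : inner ℝ n e = 0) : ‖cross e n‖ = 1 := by
  have hen : inner ℝ e n = 0 := by rw [real_inner_comm]; exact hne
  rw [norm_cross, he, hn, (InnerProductGeometry.inner_eq_zero_iff_angle_eq_pi_div_two e n).1 hen,
    Real.sin_pi_div_two]
  ring

/-- `‖s e + d n‖² = s² + d²` for orthogonal unit vectors. [folklore] -/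
private theorem farField_norm_sq_add (e n : EuclideanSpace ℝ (Fin 3)) (he : ‖e‖ = 1) (hn : ‖n‖ = 1)
    (hne : inner ℝ n e = 0) (s d : ℝ) : ‖s • e + d • n‖ ^ 2 = s ^ 2 + d ^ 2 := by
  have hen : inner ℝ e n = 0 := by rw [real_inner_comm]; exact hne
  rw [norm_add_sq_real, norm_smul, norm_smul, he, hn, real_inner_smul_left, real_inner_smul_right,
    hen]
  simp [Real.norm_eq_abs, sq_abs]

/-- `⟪s e + d n, e⟫ = s` for orthogonal unit vectors. [folklore] -/
private theorem farField_inner_add (e n : EuclideanSpace ℝ (Fin 3)) (he : ‖e‖ = 1)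
    (hne : inner ℝ n e = 0) (s d : ℝ) : inner ℝ (s • e + d • n) e = s := by
  rw [inner_add_left, real_inner_smul_left, real_inner_smul_left, hne, real_inner_self_eq_norm_sq, he]
  ring

/-- A nonnegative real whose square dominates `a²` (`a ≥ 0`) dominates `a`. [folklore] -/
private theorem farField_le_of_sq_le {a b : ℝ} (hb : 0 ≤ b) (h : a ^ 2 ≤ b ^ 2) : a ≤ b := by
  by_contra hlt
  rw [not_le] at hlt
  nlinarith [mul_lt_mul_of_pos_left hlt (lt_of_le_of_lt hb hlt)]

/-- **Tools stub (`stub_farFieldObstruction`).**  Let `U` obey the profile Type-I envelope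
`‖U y‖ ≤ C₀/(1+‖y‖)` and be `η√Γ`-close, at every point at distance `≥ ρ√Γ/4` from the straight line
`τ ↦ P + τ • e` (`‖e‖ = 1`), to the regularised Biot–Savart field of that line with circulation `Γγ`;
assume `ρ√Γ ≥ 4` (tube radius `≥` core size) and let `n ⊥ e` be a unit normal.  Then `|γ|/(πρ) ≤ η`:
the thin-filament far field is incompatible with the Type-I envelope at any finer relative precision.
(Test points `P + s e + (ρ√Γ/4) n`, `s → ∞`.) [folklore] -/
theorem stub_farFieldObstruction :
    ∀ (Γ ρ η γ C₀ : ℝ) (P e n : EuclideanSpace ℝ (Fin 3))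
      (U : EuclideanSpace ℝ (Fin 3) → EuclideanSpace ℝ (Fin 3)),
      0 < Γ → 0 < ρ → 4 ≤ ρ * Real.sqrt Γ → ‖e‖ = 1 → ‖n‖ = 1 → inner ℝ n e = 0 →
      (∀ y, ‖U y‖ ≤ C₀ / (1 + ‖y‖)) →
      (∀ y, (∀ τ : ℝ, ρ * Real.sqrt Γ / 4 ≤ ‖y - (P + τ • e)‖) →
        ‖U y - (Γ * γ / (4 * Real.pi)) • ∫ σ : ℝ, ((‖y - (P + σ • e)‖ ^ 2 + 1) ^ (3 / 2 : ℝ))⁻¹ •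
          Literature.Analysis.FluidPDE.cross e (y - (P + σ • e))‖ ≤ η * Real.sqrt Γ) →
      |γ| / (Real.pi * ρ) ≤ η := by
  intro Γ ρ η γ C₀ P e n U hΓ hρ hρΓ he hn hne hdec hclose
  by_contra hlt
  rw [not_le] at hlt
  -- the tube radius `d = ρ√Γ/4 ≥ 1`, `t = √Γ`, and the positive gap `ε`
  set t : ℝ := Real.sqrt Γ with ht
  have ht0 : 0 < t := Real.sqrt_pos.2 hΓ
  have htt : t * t = Γ := Real.mul_self_sqrt hΓ.le
  set d : ℝ := ρ * t / 4 with hd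
  have hd0 : 0 < d := by rw [hd]; positivity
  set ε : ℝ := (|γ| / (π * ρ) - η) * t with hε
  have hε0 : 0 < ε := mul_pos (sub_pos.2 hlt) ht0
  -- a test point far along the line, on the tube boundary
  set s : ℝ := ‖P‖ + d + |C₀| / ε + 1 with hs
  set y : EuclideanSpace ℝ (Fin 3) := P + (s • e + d • n) with hy
  have hyP : y - P = s • e + d • n := by rw [hy]; abel
  -- `y` is admissible: at distance `≥ d` from every point of the line
  have hadm : ∀ τ : ℝ, ρ * Real.sqrt Γ / 4 ≤ ‖y - (P + τ • e)‖ := by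
    intro τ
    have h1 : y - (P + τ • e) = (s - τ) • e + d • n := by
      rw [hy, sub_smul]; abel
    rw [h1, ← ht, ← hd]
    refine farField_le_of_sq_le (norm_nonneg _) ?_
    rw [farField_norm_sq_add e n he hn hne]
    nlinarith [sq_nonneg (s - τ)]
  -- the line field at `y` in closed form: `(Γγ/4π) (2/(d²+1)) d (e × n)`
  obtain ⟨-, hint⟩ := SkeletonEquilibrium.Sketch.stub_lineBiotSavart P e y he
  have hcoef : ‖y - P‖ ^ 2 - (inner ℝ (y - P) e) ^ 2 + 1 = d ^ 2 + 1 := by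
    rw [hyP, farField_norm_sq_add e n he hn hne, farField_inner_add e n he hne]; ring
  rw [hcoef, hyP, farField_cross_add_smul] at hint
  set uy : EuclideanSpace ℝ (Fin 3) := (Γ * γ / (4 * π)) • ∫ σ : ℝ,
    ((‖y - (P + σ • e)‖ ^ 2 + 1) ^ (3 / 2 : ℝ))⁻¹ • cross e (y - (P + σ • e)) with huy
  have huy' : uy = (Γ * γ / (4 * π)) • ((2 / (d ^ 2 + 1)) • (d • cross e n)) := by
    rw [huy, hint]
  have hnorm : ‖uy‖ = Γ * |γ| * d / (2 * π * (d ^ 2 + 1)) := by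
    have hd2 : 0 < d ^ 2 + 1 := by positivity
    rw [huy', norm_smul, norm_smul, norm_smul, farField_norm_cross_of_orthonormal he hn hne,
      Real.norm_eq_abs, Real.norm_eq_abs, Real.norm_eq_abs, abs_of_pos hd0,
      abs_of_pos (div_pos two_pos hd2), abs_div, abs_mul, abs_of_pos hΓ,
      abs_of_pos (by positivity : (0 : ℝ) < 4 * π)]
    field_simp
    ring
  -- lower bound `‖uy‖ ≥ |γ| t / (π ρ)` (uses `ρ t ≥ 4`, i.e. `d ≥ 1`)
  have hlow : |γ| * t / (π * ρ) ≤ ‖uy‖ := by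
    rw [hnorm, div_le_div_iff₀ (by positivity) (by positivity), hd, ← htt]
    have h1 : 0 ≤ |γ| * π * t := by positivity
    have h2 : 0 ≤ (ρ * t) ^ 2 - 16 := by nlinarith [hρΓ]
    nlinarith [mul_nonneg h1 h2]
  -- so `‖U y‖ ≥ ε`
  have hUy : ε ≤ ‖U y‖ := by
    have hc := hclose y hadm
    have htri : ‖uy‖ - ‖U y‖ ≤ ‖U y - uy‖ := by
      rw [← norm_neg (U y - uy), neg_sub]; exact norm_sub_norm_le uy (U y)
    have : ε = |γ| * t / (π * ρ) - η * t := by rw [hε]; ring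
    rw [this]
    linarith
  -- but the envelope makes `‖U y‖ < ε` that far out
  have hyl : |C₀| / ε < 1 + ‖y‖ := by
    have hv : s ≤ ‖s • e + d • n‖ := by
      refine farField_le_of_sq_le (norm_nonneg _) ?_
      rw [farField_norm_sq_add e n he hn hne]
      nlinarith
    have hy1 : ‖s • e + d • n‖ ≤ ‖y‖ + ‖P‖ := by
      calc ‖s • e + d • n‖ = ‖y - P‖ := by rw [hyP]
        _ ≤ ‖y‖ + ‖P‖ := norm_sub_le y P
    have : s - ‖P‖ = d + |C₀| / ε + 1 := by rw [hs]; ring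
    linarith
  have hsmall : C₀ / (1 + ‖y‖) < ε := by
    have hpos : 0 < 1 + ‖y‖ := by positivity
    rw [div_lt_iff₀ hpos]
    calc C₀ ≤ |C₀| := le_abs_self C₀
      _ = ε * (|C₀| / ε) := by field_simp
      _ < ε * (1 + ‖y‖) := mul_lt_mul_of_pos_left hyl hε0
  exact absurd (hUy.trans (hdec y)) (not_le.2 hsmall)

end Summit.NavierStokesRegularity.NavierStokesRegularity.Theorems
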